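import Summits.NavierStokesRegularity.OSWSelfSimilar.SheetRLinearisedFlow
import Literature.Analysis.UnboundedOperators.RankOneDuhamelRenewal
import HarnessLib

/-!
# SHEET-ℝ frame, renewal route (R-a)/(R-d) on the sheet: the linearised flow `e^{τ(T + θℓ(·)f)}` obeys a scalar RENEWAL EQUATION whose
# kernel `k(τ) = θℓ(S(τ)f)` has Laplace transform `1 − E(σ)`, `E` = the Evans function of record

HONEST FRAMING (cell ns-blowup GROUP B / zone Z3, case Z3-SR-SPEC, P-list items (P9) KERNEL / (P10) NOT CLAIMED; renewal route of
profile-cert-5's P9-P10-RENEWAL-DESIGN.md v2 3404fb3ef9cec7d2: (R-a) rank-one Duhamel ⇒ scalar renewal (selfsim g13, generic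
`Literature/Analysis/UnboundedOperators/RankOneDuhamelRenewal.lean`), (R-b) decay bookkeeping (cert-5 g6 `SheetRRenewalBookkeeping`), (R-c) half-line
Paley–Wiener with a pole (cert-5 g7, in progress), (R-d) composition; 1-D MODEL certificate frame (viscous gCLM/OSW sheet on the line); not Euler/NS;
«violates: none — MODEL»).  Nothing here asserts that a profile or an eigenvalue exists: the Gårding datum ((S1), interval arithmetic) is the
HYPOTHESIS `GardingDataKC`; `ℓ`, `f`, `θ` are ARBITRARY (dictionary: `−DG(Ω*)|odd = T + θℓ(·)f`, `T = generatorOdd`, `E = evansOdd hL K h ℓ f θ`).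

For ANY pair of C₀-semigroups `S`, `S_F` on `Wcodd L` with the generator data delivered by `SheetRLinearisedSemigroup.exists_c0Semigroup`
(`S.generator = T`, Laplace transform `= resolventOdd`, `‖S(τ)‖ ≤ e^{−mτ}`) and `SheetRLinearisedFlow.exists_c0Semigroup_full` (`D(S_F.generator) = D(T)`,
`S_F.generator u = Tu + θℓ(u)f`) — by `C0Semigroup.eq_of_generator_eq` these are THE two semigroups — this file proves:

* **`renewal_equation_sheet`** — for every `δ₀ ∈ L²_{w,odd}(ℂ)` and `t ≥ 0`, with `m(t) := θℓ(S_F(t)δ₀)`, `m₀(t) := θℓ(S(t)δ₀)`, `k(τ) := θℓ(S(τ)f)`: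
  `m(t) = m₀(t) + ∫₀ᵗ k(t − s) m(s) ds` (the Volterra/renewal equation of the gauge coordinate of the linearised flow), together with the
  reconstruction `S_F(t)δ₀ = S(t)δ₀ + ∫₀ᵗ m(s)·S(t − s)f ds` (`flow_eq_add_integral_sheet`) and the bounds `|k(τ)| ≤ ‖θ‖‖ℓ‖‖f‖e^{−mτ}`,
  `|m₀(t)| ≤ ‖θ‖‖ℓ‖‖δ₀‖e^{−mt}` (`norm_kernel_le_sheet`, `norm_forcing_le_sheet`);
* **`laplace_kernel_eq_one_sub_evansOdd`** — THE (R-d) DICTIONARY: `∫₀^∞ e^{−στ}k(τ) dτ = θℓ(R_K(σ)f) = 1 − E(σ)` for every `Re σ > −m`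
  (Laplace bridge `laplaceResolventFun S = resolventOdd` + `ℓ` commutes with the Bochner integral); so the symbol `1 − k̂` of the renewal equation
  IS the Evans function `evansOdd` of `SheetREvansOdd`, whose zero set in `{Re σ > −3/100}` the S2 certificate pins to `{1}` (simple).
No definition, no named fact.  WHAT THIS IS NOT: not NS; not (R-c) (no Laplace inversion / resolvent-kernel decomposition is done here) and not the
stability word; no number of record moves.
-/

noncomputable section

namespace Summit.NavierStokesRegularity.OSWSelfSimilar
namespace SheetRLinearisedRenewal

open _root_.MeasureTheory _root_.Set _root_.Filter SheetREnergySpace SheetRComplexPivot SheetRPerturbedResolventC SheetROddClass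
  SheetRResolventOddClass SheetRGeneratorOddWeak SheetREvansOdd SheetRLinearisedSemigroup SheetRLinearisedFlow
  Literature.Analysis.OperatorTheory Literature.Analysis.UnboundedOperators
open scoped Topology NNReal

variable {L D₀ D₁ V₀ c m : ℝ} {d V : ℝ → ℝ}

/-! ### §1 From the generator data to the hypotheses of the generic renewal theorem -/

/-- The generator of `S_F` differs from that of `S` by the rank-one operator `(θ•ℓ)(·)f` on the common domain — the hypotheses `hdom`/`hgen` of
`C0Semigroup.renewal_equation`, read off the conclusions of `exists_c0Semigroup` / `exists_c0Semigroup_full`. [folklore] -/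
theorem generator_data (hL : 0 < L) (K : Esp L hL →L[ℝ] W L) (h : GardingDataKC L hL d V K D₀ D₁ V₀ c m) {σ₀ : ℂ} (hσ₀ : -m < σ₀.re)
    (ℓ : Wcodd L →L[ℂ] ℂ) (f : Wcodd L) (θ : ℂ) (S SF : C0Semigroup ℂ (Wcodd L)) (hS : S.generator = generatorOdd hL K h σ₀ hσ₀)
    (hdomF : (SF.generator.domain : Set (Wcodd L)) = (generatorOdd hL K h σ₀ hσ₀).domain)
    (hgenF : ∀ (u : Wcodd L) (hu : u ∈ (generatorOdd hL K h σ₀ hσ₀).domain), ∃ hu' : u ∈ SF.generator.domain,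
      SF.generator ⟨u, hu'⟩ = generatorOdd hL K h σ₀ hσ₀ ⟨u, hu⟩ + (θ * ℓ u) • f) :
    (∀ u : Wcodd L, u ∈ SF.generator.domain ↔ u ∈ S.generator.domain) ∧
      ∀ (u : Wcodd L) (hSF : u ∈ SF.generator.domain) (hS' : u ∈ S.generator.domain),
        SF.generator ⟨u, hSF⟩ = S.generator ⟨u, hS'⟩ + (θ • ℓ) u • f := by
  have hdom : ∀ u : Wcodd L, u ∈ SF.generator.domain ↔ u ∈ S.generator.domain := by
    intro u
    rw [hS, ← SetLike.mem_coe, hdomF, SetLike.mem_coe]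
  refine ⟨hdom, fun u hSF hS' => ?_⟩
  have huT : u ∈ (generatorOdd hL K h σ₀ hσ₀).domain := by rw [← hS]; exact hS'
  obtain ⟨hu', hB⟩ := hgenF u huT
  have hTS : generatorOdd hL K h σ₀ hσ₀ ⟨u, huT⟩ = S.generator ⟨u, hS'⟩ := by
    have hgr : ((u : Wcodd L), S.generator ⟨u, hS'⟩) ∈ (generatorOdd hL K h σ₀ hσ₀).graph := by
      rw [← hS]; exact S.generator.mem_graph ⟨u, hS'⟩
    exact (generatorOdd hL K h σ₀ hσ₀).mem_graph_snd_inj (LinearPMap.mem_graph _ ⟨u, huT⟩) hgr rfl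
  have heq : (⟨u, hSF⟩ : SF.generator.domain) = ⟨u, hu'⟩ := rfl
  rw [heq, hB, hTS, smul_apply, smul_eq_mul]

/-! ### §2 The renewal equation of the linearised flow -/

/-- **THE RENEWAL EQUATION ON THE SHEET ((R-a) instantiated).**  `m(t) = θℓ(S_F(t)δ₀)` satisfies `m(t) = θℓ(S(t)δ₀) + ∫₀ᵗ θℓ(S(t − s)f)·m(s) ds`
for every `δ₀` and `t ≥ 0`. 1-D MODEL; the semigroups are hypotheses-by-generator (they exist under (S1) alone by the two (P9) files); NOT NS.
[cite: EngelNagel2000, Ch. III Cor. 1.7] -/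
theorem renewal_equation_sheet (hL : 0 < L) (K : Esp L hL →L[ℝ] W L) (h : GardingDataKC L hL d V K D₀ D₁ V₀ c m) {σ₀ : ℂ} (hσ₀ : -m < σ₀.re)
    (ℓ : Wcodd L →L[ℂ] ℂ) (f : Wcodd L) (θ : ℂ) (S SF : C0Semigroup ℂ (Wcodd L)) (hS : S.generator = generatorOdd hL K h σ₀ hσ₀)
    (hdomF : (SF.generator.domain : Set (Wcodd L)) = (generatorOdd hL K h σ₀ hσ₀).domain)
    (hgenF : ∀ (u : Wcodd L) (hu : u ∈ (generatorOdd hL K h σ₀ hσ₀).domain), ∃ hu' : u ∈ SF.generator.domain,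
      SF.generator ⟨u, hu'⟩ = generatorOdd hL K h σ₀ hσ₀ ⟨u, hu⟩ + (θ * ℓ u) • f)
    (δ₀ : Wcodd L) {t : ℝ} (ht : 0 ≤ t) :
    θ * ℓ (SF.app t.toNNReal δ₀) = θ * ℓ (S.app t.toNNReal δ₀)
      + ∫ s in (0 : ℝ)..t, (θ * ℓ (S.app (t - s).toNNReal f)) * (θ * ℓ (SF.app s.toNNReal δ₀)) := by
  haveI : CompleteSpace (Wcodd L) := completeSpace_Wcodd L
  obtain ⟨hdom, hgen⟩ := generator_data hL K h hσ₀ ℓ f θ S SF hS hdomF hgenF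
  have key := C0Semigroup.renewal_equation SF S (θ • ℓ) f hdom hgen δ₀ ht
  simpa only [smul_apply, smul_eq_mul] using key

/-- **Reconstruction of the flow from the gauge coordinate**: `S_F(t)δ₀ = S(t)δ₀ + ∫₀ᵗ m(s)·S(t − s)f ds`, `m(s) = θℓ(S_F(s)δ₀)`.
[cite: EngelNagel2000, Ch. III Cor. 1.7] -/
theorem flow_eq_add_integral_sheet (hL : 0 < L) (K : Esp L hL →L[ℝ] W L) (h : GardingDataKC L hL d V K D₀ D₁ V₀ c m) {σ₀ : ℂ} (hσ₀ : -m < σ₀.re)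
    (ℓ : Wcodd L →L[ℂ] ℂ) (f : Wcodd L) (θ : ℂ) (S SF : C0Semigroup ℂ (Wcodd L)) (hS : S.generator = generatorOdd hL K h σ₀ hσ₀)
    (hdomF : (SF.generator.domain : Set (Wcodd L)) = (generatorOdd hL K h σ₀ hσ₀).domain)
    (hgenF : ∀ (u : Wcodd L) (hu : u ∈ (generatorOdd hL K h σ₀ hσ₀).domain), ∃ hu' : u ∈ SF.generator.domain,
      SF.generator ⟨u, hu'⟩ = generatorOdd hL K h σ₀ hσ₀ ⟨u, hu⟩ + (θ * ℓ u) • f)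
    (δ₀ : Wcodd L) {t : ℝ} (ht : 0 ≤ t) :
    SF.app t.toNNReal δ₀ = S.app t.toNNReal δ₀ + ∫ s in (0 : ℝ)..t, (θ * ℓ (SF.app s.toNNReal δ₀)) • S.app (t - s).toNNReal f := by
  haveI : CompleteSpace (Wcodd L) := completeSpace_Wcodd L
  obtain ⟨hdom, hgen⟩ := generator_data hL K h hσ₀ ℓ f θ S SF hS hdomF hgenF
  have key := C0Semigroup.app_eq_add_integral_rankOne SF S (θ • ℓ) f hdom hgen δ₀ ht
  simpa only [smul_apply, smul_eq_mul] using key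

/-- **Kernel bound**: `|k(τ)| = |θℓ(S(τ)f)| ≤ ‖θ‖‖ℓ‖‖f‖·e^{−mτ}` from `‖S(τ)‖ ≤ e^{−mτ}`. [cite: EngelNagel2000, Ch. III Cor. 1.7] -/
theorem norm_kernel_le_sheet (ℓ : Wcodd L →L[ℂ] ℂ) (f : Wcodd L) (θ : ℂ) (S : C0Semigroup ℂ (Wcodd L))
    (hM : ∀ τ : ℝ≥0, ‖S.app τ‖ ≤ Real.exp (-m * τ)) (τ : ℝ≥0) :
    ‖θ * ℓ (S.app τ f)‖ ≤ ‖θ‖ * ‖ℓ‖ * ‖f‖ * Real.exp (-m * τ) := by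
  have hM' : ∀ t : ℝ≥0, ‖S.app t‖ ≤ 1 * Real.exp (-m * t) := fun t => by rw [one_mul]; exact hM t
  have h := C0Semigroup.norm_kernel_le S hM' (θ • ℓ) f τ
  rw [smul_apply, smul_eq_mul] at h
  calc ‖θ * ℓ (S.app τ f)‖ ≤ ‖θ • ℓ‖ * (1 * Real.exp (-m * τ)) * ‖f‖ := h
    _ ≤ ‖θ‖ * ‖ℓ‖ * (1 * Real.exp (-m * τ)) * ‖f‖ := by
        gcongr; exact ContinuousLinearMap.opNorm_smul_le θ ℓ
    _ = ‖θ‖ * ‖ℓ‖ * ‖f‖ * Real.exp (-m * τ) := by ring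

/-- **Forcing bound**: `|m₀(t)| = |θℓ(S(t)δ₀)| ≤ ‖θ‖‖ℓ‖‖δ₀‖·e^{−mt}`. [cite: EngelNagel2000, Ch. III Cor. 1.7] -/
theorem norm_forcing_le_sheet (ℓ : Wcodd L →L[ℂ] ℂ) (θ : ℂ) (S : C0Semigroup ℂ (Wcodd L))
    (hM : ∀ τ : ℝ≥0, ‖S.app τ‖ ≤ Real.exp (-m * τ)) (δ₀ : Wcodd L) (t : ℝ≥0) :
    ‖θ * ℓ (S.app t δ₀)‖ ≤ ‖θ‖ * ‖ℓ‖ * ‖δ₀‖ * Real.exp (-m * t) :=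
  norm_kernel_le_sheet ℓ δ₀ θ S hM t

/-! ### §3 The Laplace transform of the kernel is `1 − E` -/

/-- `θℓ(∫₀^∞ e^{−στ}S(τ)f dτ) = 1 − E(σ)`: the Laplace bridge `laplaceResolventFun S σ = resolventOdd σ` makes `θℓ(R_K(σ)f)` appear, which is
`1 − evansOdd σ` by definition. [folklore] -/
theorem mul_apply_laplace_eq (hL : 0 < L) (K : Esp L hL →L[ℝ] W L) (h : GardingDataKC L hL d V K D₀ D₁ V₀ c m)
    (ℓ : Wcodd L →L[ℂ] ℂ) (f : Wcodd L) (θ : ℂ) (S : C0Semigroup ℂ (Wcodd L))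
    (hlap : ∀ σ : ℂ, -m < σ.re → ∀ G : Wcodd L, S.laplaceResolventFun σ G = resolventOdd hL K h σ G) {σ : ℂ} (hσ : -m < σ.re) :
    θ * ℓ (S.laplaceResolventFun σ f) = 1 - evansOdd hL K h ℓ f θ σ := by
  rw [hlap σ hσ f, evansOdd]
  ring

/-- **THE (R-d) DICTIONARY: the Laplace transform of the renewal kernel is `1 − E`.**  For `S` with `‖S(τ)‖ ≤ e^{−mτ}` and Laplace transform
`resolventOdd` (the coercive semigroup of `SheetRLinearisedSemigroup.exists_c0Semigroup`), and every `σ` with `Re σ > −m`: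
`∫₀^∞ e^{−στ}·θℓ(S(τ)f) dτ = 1 − evansOdd hL K h ℓ f θ σ`.  Hence the symbol `1 − k̂(σ)` of the renewal equation `renewal_equation_sheet` IS the Evans
function of record, whose zeros in `{Re σ > −3/100}` the S2 certificate pins to the simple zero `σ = 1`. 1-D MODEL; NOT NS; no inversion is done here.
[folklore] -/
theorem laplace_kernel_eq_one_sub_evansOdd (hL : 0 < L) (K : Esp L hL →L[ℝ] W L) (h : GardingDataKC L hL d V K D₀ D₁ V₀ c m)
    (ℓ : Wcodd L →L[ℂ] ℂ) (f : Wcodd L) (θ : ℂ) (S : C0Semigroup ℂ (Wcodd L)) (hM : ∀ τ : ℝ≥0, ‖S.app τ‖ ≤ Real.exp (-m * τ))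
    (hlap : ∀ σ : ℂ, -m < σ.re → ∀ G : Wcodd L, S.laplaceResolventFun σ G = resolventOdd hL K h σ G) {σ : ℂ} (hσ : -m < σ.re) :
    ∫ τ in Ioi (0 : ℝ), Complex.exp (-(σ * τ)) * (θ * ℓ (S.app (Real.toNNReal τ) f)) = 1 - evansOdd hL K h ℓ f θ σ := by
  haveI : CompleteSpace (Wcodd L) := completeSpace_Wcodd L
  have hM' : ∀ t : ℝ≥0, ‖S.app t‖ ≤ 1 * Real.exp (-m * t) := fun t => by rw [one_mul]; exact hM t
  have hint := C0Semigroup.integrableOn_integrand S hM' (l := σ) (by linarith) f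
  -- `θℓ` commutes with the Bochner integral over `(0, ∞)`
  have hcomm := ((θ • ℓ).integral_comp_comm hint)
  -- rewrite the integrand `(θℓ)(e^{−στ} • S(τ)f) = e^{−στ}·θℓ(S(τ)f)`
  have hcongr : (fun τ : ℝ => (θ • ℓ) (Complex.exp (-(σ * τ)) • S.app (Real.toNNReal τ) f)) =
      fun τ : ℝ => Complex.exp (-(σ * τ)) * (θ * ℓ (S.app (Real.toNNReal τ) f)) := by
    funext τ
    rw [map_smul, smul_apply, smul_eq_mul, smul_eq_mul]
  rw [hcongr] at hcomm
  have hdef : (∫ τ in Ioi (0 : ℝ), Complex.exp (-(σ * τ)) • S.app (Real.toNNReal τ) f) = S.laplaceResolventFun σ f := rfl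
  rw [hcomm, smul_apply, smul_eq_mul, hdef]
  exact mul_apply_laplace_eq hL K h ℓ f θ S hlap hσ

end SheetRLinearisedRenewal
end Summit.NavierStokesRegularity.OSWSelfSimilar

end
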